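import Summits.ResolutionOfSingularities.ResolutionOfSingularities.Theorems.MarkedTransferCampaignW46MohWindowSurfaceFormTransfer
import Summits.ResolutionOfSingularities.ResolutionOfSingularities.Theorems.MarkedTransferCampaignW46MohWindowSurfaceLocal
import Mathlib.Algebra.CharP.Lemmas
import HarnessLib

/-!
# [OURS · L1 W4.6 rung (iii-2), HEAVY-ROOT SIDE, `p = 2`] Surface Moh window — the FROZEN SHAPE: a window ideal
# `(w² + s²η + r)`, `η ∈ 𝔪` with a unit `q`-component, `r ∈ 𝔪⁴`, has in EVERY coefficient window presentation a residue cubic with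
# a simple prime factor (cell res-hironaka, LADDER-RESOLUTION rung L, D-0089; seat res-L1-s46-pv-5 gen 4; host MarkedTransfer,
# `--supports stmt-ResolutionOfSingularities-16155 --as helper`; statement file `…CampaignW46MohWindowSurface.lean`)

HONEST FRAMING. Nothing here is a statement of H. Hironaka's manuscript [Hironaka2017] and nothing here asserts that any
statement of it holds. PURE COMMUTATIVE ALGEBRA over a regular local ring `L` of embedding dimension `3` and characteristic `2`
(the purely inseparable surface window at `p = 2` is `{d = 3}`): step (2)–(3) of res-L1-s46-pv-5's «p = 2 programme» (NOTES), on
top of the residue-form TRANSFER (`…FormTransfer.lean`) and the top-of-window rigidity (`…Freeze*.lean`). AI-written; AI review is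
weaker than expert review. No `sorry`; axioms standard.

THE POINT. After a blow-up of the surface window at `p = 2` the transform at a point over the centre has, in the chart parameters
`(s, q, w)` (`s` the exceptional equation), the shape `J = (w² + s²·η + r)` with `η ∈ 𝔪` and `r ∈ 𝔪⁴` (cleaning done). Write
`η ≡ η_S s + η_Q q + η_W w (mod 𝔪²)`. `exists_simple_factor_of_frozenShape`: if `η_Q` is a UNIT («frozen shape»), then for EVERY
coefficient window presentation `J = (z² + Σ_{k ≤ 3} a_k x^{3−k} y^k)` the residue cubic `Σ ā_k Y^k` — or its reversal
`Σ ā_{3−k} Y^k` (the swapped presentation `(y, x)`, `coeffForm_swap`) — has a prime factor of multiplicity one; so by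
`…Freeze.lean` such a point is NEVER an admitted centre of a sequence that stays in `Regime.mohWindowSurface`. Mechanism: by the
TRANSFER the residue cubic is `ū · S̄² · (η̄_S S̄ + η̄_Q Q̄)` where `S̄ = ā₁X + ā₂Y`, `Q̄ = b̄₁X + b̄₂Y` are the traces of `s, q` on the
presentation's plane (`s = a₁x + a₂y + a₃z`, `q = b₁x + b₂y + b₃z`), linearly independent by quasi-regularity
(`residue_det_ne_zero`); a square times an independent linear form has a simple factor. [ZariskiSamuel1960] [Matsumura1987]
[HauserWagner2014]
-/

noncomputable section

set_option linter.dupNamespace false -- mandated namespace of this single-conjunct summit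

namespace Summit.ResolutionOfSingularities.ResolutionOfSingularities.Theorems.CampaignW46.MohWindowSurface

open IsLocalRing MvPolynomial
open Literature.AlgebraicGeometry.Resolution
open Summit.ResolutionOfSingularities.ResolutionOfSingularities.Theorems.CampaignW46.MohWindowSurfaceResidualOrder

universe u

variable {L : Type u} [CommRing L] [IsRegularLocalRing L]

/-! ## 1. Two regular systems of parameters: the `2 × 2` residue minor -/

/-- **Independence of the traces.** Let `(s, q, w)` and `(x, y, z)` be regular systems of parameters of a regular local ring of
embedding dimension `3`, `s = a₁x + a₂y + a₃z`, `q = b₁x + b₂y + b₃z`, `w = αx + βy + λz` with `α, β ∈ 𝔪` and `λ` a unit (the plane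
`z = 0` is the plane `w = 0` to first order). Then the minor `a₁b₂ − a₂b₁` is a unit: the traces of `s, q` on the plane are
linearly independent over the residue field (degree-one quasi-regularity). [cite: Matsumura1987, Thm. 16.2 (i)] -/
theorem residue_det_isUnit (h3 : (maximalIdeal L).spanFinrank = 3) {s q w x y z : L}
    (hsqw : Ideal.span {s, q, w} = maximalIdeal L) (hxyz : Ideal.span {x, y, z} = maximalIdeal L)
    {a₁ a₂ a₃ b₁ b₂ b₃ α β lam : L} (hs : s = a₁ * x + a₂ * y + a₃ * z) (hq : q = b₁ * x + b₂ * y + b₃ * z)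
    (hw : w = α * x + β * y + lam * z) (hα : α ∈ maximalIdeal L) (hβ : β ∈ maximalIdeal L) (hlam : IsUnit lam) :
    IsUnit (a₁ * b₂ - a₂ * b₁) := by
  have hR : IsRegularLocalRing L := inferInstance
  by_contra hD
  have hDm : a₁ * b₂ - a₂ * b₁ ∈ maximalIdeal L := (mem_maximalIdeal _).mpr (mem_nonunits_iff.mpr hD)
  have hx : x ∈ maximalIdeal L := hxyz ▸ Ideal.subset_span (by simp)
  have hy : y ∈ maximalIdeal L := hxyz ▸ Ideal.subset_span (by simp)
  obtain ⟨lam', hlam'⟩ := hlam.exists_left_inv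
  have hz : z = lam' * (w - α * x - β * y) := by
    have : w - α * x - β * y = lam * z := by rw [hw]; ring
    rw [this, ← mul_assoc, hlam', one_mul]
  -- degree-one quasi-regularity for `(s, q, w)`
  have qr1 : ∀ {c₀ c₁ c₂ : L}, c₀ * s + c₁ * q + c₂ * w ∈ maximalIdeal L ^ 2 →
      c₀ ∈ maximalIdeal L ∧ c₁ ∈ maximalIdeal L ∧ c₂ ∈ maximalIdeal L := by
    intro c₀ c₁ c₂ h
    have h' : c₀ * s ^ 1 + c₁ * q ^ 1 + c₂ * w ^ 1 ∈ maximalIdeal L ^ (1 + 1) := by simpa only [pow_one] using h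
    exact coeffs_mem_of_pow_combination_mem hR h3 hsqw one_ne_zero h'
  have hm2 : ∀ {c v : L}, c ∈ maximalIdeal L → v ∈ maximalIdeal L → c * v ∈ maximalIdeal L ^ 2 := by
    intro c v hc hv; rw [pow_two]; exact Ideal.mul_mem_mul hc hv
  -- (i) `b₂ s − a₂ q − e λ' w ∈ 𝔪²` with `e = b₂a₃ − a₂b₃`
  have h1 : b₂ * s + (-a₂) * q + (-((b₂ * a₃ - a₂ * b₃) * lam')) * w ∈ maximalIdeal L ^ 2 := by
    have : b₂ * s + (-a₂) * q + (-((b₂ * a₃ - a₂ * b₃) * lam')) * w =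
        (a₁ * b₂ - a₂ * b₁) * x - ((b₂ * a₃ - a₂ * b₃) * lam') * (α * x) - ((b₂ * a₃ - a₂ * b₃) * lam') * (β * y) := by
      rw [hs, hq, hz]; ring
    rw [this]
    exact Ideal.sub_mem _ (Ideal.sub_mem _ (hm2 hDm hx) (Ideal.mul_mem_left _ _ (hm2 hα hx)))
      (Ideal.mul_mem_left _ _ (hm2 hβ hy))
  obtain ⟨hb₂, ha₂, -⟩ := qr1 h1
  have ha₂' : a₂ ∈ maximalIdeal L := by simpa using ha₂
  -- (ii) `b₁ s − a₁ q − e' λ' w ∈ 𝔪²`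
  have h2 : b₁ * s + (-a₁) * q + (-((b₁ * a₃ - a₁ * b₃) * lam')) * w ∈ maximalIdeal L ^ 2 := by
    have : b₁ * s + (-a₁) * q + (-((b₁ * a₃ - a₁ * b₃) * lam')) * w =
        -((a₁ * b₂ - a₂ * b₁) * y) - ((b₁ * a₃ - a₁ * b₃) * lam') * (α * x) - ((b₁ * a₃ - a₁ * b₃) * lam') * (β * y) := by
      rw [hs, hq, hz]; ring
    rw [this]
    exact Ideal.sub_mem _ (Ideal.sub_mem _ (neg_mem (hm2 hDm hy)) (Ideal.mul_mem_left _ _ (hm2 hα hx)))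
      (Ideal.mul_mem_left _ _ (hm2 hβ hy))
  obtain ⟨hb₁, ha₁, -⟩ := qr1 h2
  have ha₁' : a₁ ∈ maximalIdeal L := by simpa using ha₁
  -- (iii) `b₃ s − a₃ q ∈ 𝔪²`
  have h3' : b₃ * s + (-a₃) * q + 0 * w ∈ maximalIdeal L ^ 2 := by
    have : b₃ * s + (-a₃) * q + 0 * w = b₃ * (a₁ * x) + b₃ * (a₂ * y) - a₃ * (b₁ * x) - a₃ * (b₂ * y) := by
      rw [hs, hq]; ring
    rw [this]
    exact Ideal.sub_mem _ (Ideal.sub_mem _ (Ideal.add_mem _ (Ideal.mul_mem_left _ _ (hm2 ha₁' hx))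
      (Ideal.mul_mem_left _ _ (hm2 ha₂' hy))) (Ideal.mul_mem_left _ _ (hm2 hb₁ hx))) (Ideal.mul_mem_left _ _ (hm2 hb₂ hy))
  obtain ⟨-, ha₃, -⟩ := qr1 h3'
  have ha₃' : a₃ ∈ maximalIdeal L := by simpa using ha₃
  -- so `s ∈ 𝔪²`, contradicting minimality of the regular system of parameters `(q, w, s)`
  have hs2 : s ∈ maximalIdeal L ^ 2 := by
    rw [hs]
    exact Ideal.add_mem _ (Ideal.add_mem _ (hm2 ha₁' hx) (hm2 ha₂' hy))
      (hm2 ha₃' (hxyz ▸ Ideal.subset_span (by simp)))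
  have hrot : Ideal.span {q, w, s} = maximalIdeal L := by rw [← triple_rotate]; exact hsqw
  exact not_mem_span_pair_sup_sq h3 hrot (Ideal.mem_sup_right hs2)

/-! ## 2. The residue cubic of a frozen shape -/

/-- **[OURS · L1 W4.6 rung (iii-2), `p = 2`] THE RESIDUE CUBIC OF THE SHAPE `(w² + s²η + r)`.** Let `L` be regular local of
embedding dimension `3` and characteristic `2` with regular system of parameters `(s, q, w)`, `η ≡ η_S s + η_Q q + η_W w (mod 𝔪²)`,
`r ∈ 𝔪⁴`, and let `(w² + s²η + r) = (z² + Σ_{k ≤ 3} a_k x^{3−k} y^k)` be a coefficient window presentation. Writing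
`s = a₁x + a₂y + a₃z`, `q = b₁x + b₂y + b₃z`: for a unit `u` the residues satisfy, for every `k ≤ 3`,
`ā_k = ū · [Y^k] ((ā₁ + ā₂Y)² (ν̄₁ + ν̄₂Y))` with `νᵢ = η_S aᵢ + η_Q bᵢ + η_W wᵢ`, `w̄₁ = w̄₂ = 0` — concretely
`a₀ ≡ u a₁²ν₁`, `a₁ ≡ u (a₁²ν₂ + 2a₁a₂ν₁)`, `a₂ ≡ u (a₂²ν₁ + 2a₁a₂ν₂)`, `a₃ ≡ u a₂²ν₂ (mod 𝔪)` — and `a₁b₂ − a₂b₁` is a unit.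
NOT a statement of the manuscript. [folklore] -/
theorem frozenShape_coeff_congr [CharP L 2] (h3 : (maximalIdeal L).spanFinrank = 3) {s q w : L}
    (hsqw : Ideal.span {s, q, w} = maximalIdeal L) {η r η_S η_Q η_W : L}
    (hη : η - (η_S * s + η_Q * q + η_W * w) ∈ maximalIdeal L ^ 2) (hr : r ∈ maximalIdeal L ^ 4) {x y z : L}
    (hxyz : Ideal.span {x, y, z} = maximalIdeal L) (a : ℕ → L)
    (heq : Ideal.span {w ^ 2 + (s ^ 2 * η + r)} = Ideal.span {z ^ 2 + ∑ k ∈ Finset.range (3 + 1), a k * x ^ (3 - k) * y ^ k}) :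
    ∃ (u a₁ a₂ a₃ b₁ b₂ b₃ ν₁ ν₂ : L), IsUnit u ∧ IsUnit (a₁ * b₂ - a₂ * b₁) ∧
      s = a₁ * x + a₂ * y + a₃ * z ∧ q = b₁ * x + b₂ * y + b₃ * z ∧
      ν₁ - (η_S * a₁ + η_Q * b₁) ∈ maximalIdeal L ∧ ν₂ - (η_S * a₂ + η_Q * b₂) ∈ maximalIdeal L ∧
      a 0 - u * (a₁ ^ 2 * ν₁) ∈ maximalIdeal L ∧ a 1 - u * (a₁ ^ 2 * ν₂ + 2 * a₁ * a₂ * ν₁) ∈ maximalIdeal L ∧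
      a 2 - u * (a₂ ^ 2 * ν₁ + 2 * a₁ * a₂ * ν₂) ∈ maximalIdeal L ∧ a 3 - u * (a₂ ^ 2 * ν₂) ∈ maximalIdeal L := by
  classical
  have hR : IsRegularLocalRing L := inferInstance
  haveI := isDomain_of_isRegularLocalRing L
  have hx : x ∈ maximalIdeal L := hxyz ▸ Ideal.subset_span (by simp)
  have hy : y ∈ maximalIdeal L := hxyz ▸ Ideal.subset_span (by simp)
  have hz : z ∈ maximalIdeal L := hxyz ▸ Ideal.subset_span (by simp)
  have hs𝔪 : s ∈ maximalIdeal L := hsqw ▸ Ideal.subset_span (by simp)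
  have hq𝔪 : q ∈ maximalIdeal L := hsqw ▸ Ideal.subset_span (by simp)
  have hw𝔪 : w ∈ maximalIdeal L := hsqw ▸ Ideal.subset_span (by simp)
  -- expansions of `s`, `q` in `(x, y, z)`
  obtain ⟨a₁, r₁, hr₁, hseq⟩ := Ideal.mem_span_insert.mp (hxyz ▸ hs𝔪 : s ∈ Ideal.span ({x, y, z} : Set L))
  obtain ⟨a₂, a₃, rfl⟩ := Ideal.mem_span_pair.mp hr₁
  obtain ⟨b₁, r₂, hr₂, hqeq⟩ := Ideal.mem_span_insert.mp (hxyz ▸ hq𝔪 : q ∈ Ideal.span ({x, y, z} : Set L))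
  obtain ⟨b₂, b₃, rfl⟩ := Ideal.mem_span_pair.mp hr₂
  have hs : s = a₁ * x + a₂ * y + a₃ * z := by rw [hseq]; ring
  have hq : q = b₁ * x + b₂ * y + b₃ * z := by rw [hqeq]; ring
  -- `h = s²η + r ∈ 𝔪³`, `f ∈ 𝔪³`
  have hlin : η_S * s + η_Q * q + η_W * w ∈ maximalIdeal L :=
    Ideal.add_mem _ (Ideal.add_mem _ (Ideal.mul_mem_left _ _ hs𝔪) (Ideal.mul_mem_left _ _ hq𝔪)) (Ideal.mul_mem_left _ _ hw𝔪)
  have hη𝔪 : η ∈ maximalIdeal L := by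
    have : η = (η - (η_S * s + η_Q * q + η_W * w)) + (η_S * s + η_Q * q + η_W * w) := by ring
    rw [this]
    exact Ideal.add_mem _ (Ideal.pow_le_self two_ne_zero hη) hlin
  have hh3 : s ^ 2 * η + r ∈ maximalIdeal L ^ 3 := by
    refine Ideal.add_mem _ ?_ (Ideal.pow_le_pow_right (by norm_num) hr)
    have := Ideal.mul_mem_mul (Ideal.pow_mem_pow hs𝔪 2) hη𝔪
    rwa [← pow_succ] at this
  have hf3 : ∑ k ∈ Finset.range (3 + 1), a k * x ^ (3 - k) * y ^ k ∈ maximalIdeal L ^ 3 := by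
    have hle : Ideal.span {x, y} ≤ maximalIdeal L := by
      rw [Ideal.span_le]; intro b hb; rcases hb with rfl | rfl <;> simpa
    exact Ideal.pow_right_mono hle 3 (coeffForm_mem_span_pow x y 3 a)
  -- the tangent plane: `w = αx + βy + λz`, `α, β ∈ 𝔪`, `λ` unit
  obtain ⟨u₀, hu₀⟩ := Ideal.span_singleton_eq_span_singleton.mp heq
  have hu₀' : (↑u₀ : L) * (w ^ 2 + (s ^ 2 * η + r)) = z ^ 2 + ∑ k ∈ Finset.range (3 + 1), a k * x ^ (3 - k) * y ^ k := by
    rw [← hu₀]; ring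
  obtain ⟨α, β, lam, hweq, hα, hβ, hlam, -⟩ :=
    eq_lin_comb_of_span_eq 2 hR h3 hxyz hw𝔪 hh3 hf3 hu₀'
  have hdet : IsUnit (a₁ * b₂ - a₂ * b₁) := residue_det_isUnit h3 hsqw hxyz hs hq hweq hα hβ hlam
  -- the cubic form `H` of `h` in `(x, y, z)`: `H = Σ c_k X^{3−k}Y^k + Z · H₂`
  set ν₁ : L := η_S * a₁ + η_Q * b₁ + η_W * α with hν₁
  set ν₂ : L := η_S * a₂ + η_Q * b₂ + η_W * β with hν₂
  set ν₃ : L := η_S * a₃ + η_Q * b₃ + η_W * lam with hν₃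
  set c : ℕ → L := fun k => if k = 0 then a₁ ^ 2 * ν₁ else if k = 1 then a₁ ^ 2 * ν₂ + 2 * a₁ * a₂ * ν₁
    else if k = 2 then a₂ ^ 2 * ν₁ + 2 * a₁ * a₂ * ν₂ else a₂ ^ 2 * ν₂ with hc
  set ℓA : MvPolynomial (Fin 3) L := C a₁ * X 0 + C a₂ * X 1 with hℓA
  set ℓB : MvPolynomial (Fin 3) L := C ν₁ * X 0 + C ν₂ * X 1 with hℓB
  set H₂ : MvPolynomial (Fin 3) L := C (2 * a₃) * ℓA * ℓB + C (a₃ ^ 2) * X 2 * ℓB + C ν₃ * ℓA * ℓA +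
    C (2 * a₃ * ν₃) * ℓA * X 2 + C (a₃ ^ 2 * ν₃) * X 2 * X 2 with hH₂
  set H : MvPolynomial (Fin 3) L :=
    (∑ k ∈ Finset.range (3 + 1), monomial (Finsupp.single 0 (3 - k) + Finsupp.single 1 k) (c k)) + X 2 * H₂ with hHdef
  have hℓA1 : ℓA.IsHomogeneous 1 :=
    ((isHomogeneous_X L 0).C_mul a₁).add ((isHomogeneous_X L 1).C_mul a₂)
  have hℓB1 : ℓB.IsHomogeneous 1 :=
    ((isHomogeneous_X L 0).C_mul ν₁).add ((isHomogeneous_X L 1).C_mul ν₂)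
  have hX2 : (X 2 : MvPolynomial (Fin 3) L).IsHomogeneous 1 := isHomogeneous_X L 2
  have hH₂2 : H₂.IsHomogeneous 2 := by
    rw [hH₂]
    refine ((((?_ : (C (2 * a₃) * ℓA * ℓB).IsHomogeneous 2).add ?_).add ?_).add ?_).add ?_
    · exact (hℓA1.C_mul _).mul hℓB1
    · exact (hX2.C_mul _).mul hℓB1
    · exact (hℓA1.C_mul _).mul hℓA1
    · exact (hℓA1.C_mul _).mul hX2
    · exact (hX2.C_mul _).mul hX2
  have hH : H.IsHomogeneous 3 := by
    rw [hHdef]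
    exact (isHomogeneous_xyForm 3 c).add (hX2.mul hH₂2)
  -- `eval H = s² (η_S s + η_Q q + η_W w)`
  have hevH : eval ![x, y, z] H = s ^ 2 * (η_S * s + η_Q * q + η_W * w) := by
    rw [hHdef, map_add, eval_xyForm, map_mul, eval_X]
    simp only [hH₂, hℓA, hℓB, map_add, map_mul, eval_C, eval_X, Matrix.cons_val_zero, Matrix.cons_val_one,
      Matrix.cons_val_two, Matrix.tail_cons, Matrix.head_cons, Finset.sum_range_succ, Finset.sum_range_zero, hc]
    simp only [show (3 : ℕ) - 0 = 3 from rfl, show (3 : ℕ) - 1 = 2 from rfl, show (3 : ℕ) - 2 = 1 from rfl,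
      show (3 : ℕ) - 3 = 0 from rfl]
    norm_num
    rw [hs, hq, hweq, hν₁, hν₂, hν₃]
    ring
  have hh : (s ^ 2 * η + r) - eval ![x, y, z] H ∈ maximalIdeal L ^ (3 + 1) := by
    rw [hevH]
    have : s ^ 2 * η + r - s ^ 2 * (η_S * s + η_Q * q + η_W * w) = s ^ 2 * (η - (η_S * s + η_Q * q + η_W * w)) + r := by ring
    rw [this]
    refine Ideal.add_mem _ ?_ hr
    have := Ideal.mul_mem_mul (Ideal.pow_mem_pow hs𝔪 2) hη
    rwa [← pow_add] at this
  -- TRANSFER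
  obtain ⟨u, hu, hcoef⟩ := coeff_sub_mul_coeff_mem_of_span_eq 2 hR h3 hxyz (by norm_num) (by norm_num) a hw𝔪 hH hh heq
  have hcoefH : ∀ k ≤ 3, H.coeff (Finsupp.single 0 (3 - k) + Finsupp.single 1 k) = c k := by
    intro k hk
    rw [hHdef, coeff_add, coeff_xyForm hk, coeff_X_mul', if_neg, add_zero]
    simp
  refine ⟨u, a₁, a₂, a₃, b₁, b₂, b₃, ν₁, ν₂, hu, hdet, hs, hq, ?_, ?_, ?_, ?_, ?_, ?_⟩
  · rw [hν₁, show η_S * a₁ + η_Q * b₁ + η_W * α - (η_S * a₁ + η_Q * b₁) = η_W * α from by ring]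
    exact Ideal.mul_mem_left _ _ hα
  · rw [hν₂, show η_S * a₂ + η_Q * b₂ + η_W * β - (η_S * a₂ + η_Q * b₂) = η_W * β from by ring]
    exact Ideal.mul_mem_left _ _ hβ
  · have := hcoef 0 (by norm_num); rwa [hcoefH 0 (by norm_num)] at this
  · have := hcoef 1 (by norm_num); rwa [hcoefH 1 (by norm_num)] at this
  · have := hcoef 2 (by norm_num); rwa [hcoefH 2 (by norm_num)] at this
  · have := hcoef 3 (by norm_num); rwa [hcoefH 3 (by norm_num)] at this

/-! ## 3. A simple prime factor, in one of the two charts -/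

/-- **[OURS · L1 W4.6 rung (iii-2), `p = 2`] A FROZEN SHAPE HAS A SIMPLE FACTOR IN EVERY PRESENTATION.** In the situation of
`frozenShape_coeff_congr` with `η_Q` a UNIT, the residue cubic `Σ_{k ≤ 3} ā_k X^k` of the presentation, or the residue cubic
`Σ_{k ≤ 3} ā_{3−k} X^k` of the swapped presentation `(y, x)` (`coeffForm_swap`), factors as `π · G₀` with `π` prime and `π ∤ G₀`
— the hypothesis of the top-of-window rigidity theorem `exists_mem_sing_not_coeffAt_of_simple_root` (`…Freeze.lean`, `d + 1 = 2p`
with `p = 2`, `d = 3`). Indeed the cubic is `ū (ā₁ + ā₂X)² (ν̄₁ + ν̄₂X)` with `ā₁ν̄₂ − ā₂ν̄₁ = η̄_Q (ā₁b̄₂ − ā₂b̄₁) ≠ 0`: if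
`ν̄₂ ≠ 0` the factor `X + ν̄₁/ν̄₂` is simple, else the reversed cubic is `ū ν̄₁ X (ā₂ + ā₁X)²` with the simple factor `X`. NOT a
statement of the manuscript. [folklore] -/
theorem exists_simple_factor_of_frozenShape [CharP L 2] (h3 : (maximalIdeal L).spanFinrank = 3) {s q w : L}
    (hsqw : Ideal.span {s, q, w} = maximalIdeal L) {η r η_S η_Q η_W : L}
    (hη : η - (η_S * s + η_Q * q + η_W * w) ∈ maximalIdeal L ^ 2) (hηQ : IsUnit η_Q) (hr : r ∈ maximalIdeal L ^ 4)
    {x y z : L} (hxyz : Ideal.span {x, y, z} = maximalIdeal L) (a : ℕ → L)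
    (heq : Ideal.span {w ^ 2 + (s ^ 2 * η + r)} = Ideal.span {z ^ 2 + ∑ k ∈ Finset.range (3 + 1), a k * x ^ (3 - k) * y ^ k}) :
    (∃ π G₀ : Polynomial (ResidueField L), Prime π ∧
        (∑ k ∈ Finset.range (3 + 1), Polynomial.C (residue L (a k)) * Polynomial.X ^ k) = π * G₀ ∧ ¬ π ∣ G₀) ∨
      (∃ π G₀ : Polynomial (ResidueField L), Prime π ∧
        (∑ k ∈ Finset.range (3 + 1), Polynomial.C (residue L (a (3 - k))) * Polynomial.X ^ k) = π * G₀ ∧ ¬ π ∣ G₀) := by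
  classical
  obtain ⟨u, a₁, a₂, a₃, b₁, b₂, b₃, ν₁, ν₂, hu, hdet, -, -, hν₁, hν₂, h0, h1, h2, h3'⟩ :=
    frozenShape_coeff_congr h3 hsqw hη hr hxyz a heq
  -- pass to the residue field
  set κ := ResidueField L
  have res_eq : ∀ {c e : L}, c - e ∈ maximalIdeal L → residue L c = residue L e := fun h =>
    (Ideal.Quotient.mk_eq_mk_iff_sub_mem _ _).mpr h
  have res_ne : ∀ {c : L}, IsUnit c → residue L c ≠ 0 := fun hc h =>
    ((mem_maximalIdeal _).mp ((residue_eq_zero_iff _).mp h)) hc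
  set U := residue L u with hU
  set A₁ := residue L a₁ with hA₁
  set A₂ := residue L a₂ with hA₂
  set N₁ := residue L ν₁ with hN₁
  set N₂ := residue L ν₂ with hN₂
  have hU0 : U ≠ 0 := res_ne hu
  have e0 : residue L (a 0) = U * (A₁ ^ 2 * N₁) := by
    rw [res_eq h0]; simp only [map_mul, map_pow]; rfl
  have e1 : residue L (a 1) = U * (A₁ ^ 2 * N₂ + 2 * A₁ * A₂ * N₁) := by
    rw [res_eq h1]; simp only [map_mul, map_add, map_pow, map_ofNat]; rfl
  have e2 : residue L (a 2) = U * (A₂ ^ 2 * N₁ + 2 * A₁ * A₂ * N₂) := by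
    rw [res_eq h2]; simp only [map_mul, map_add, map_pow, map_ofNat]; rfl
  have e3 : residue L (a 3) = U * (A₂ ^ 2 * N₂) := by
    rw [res_eq h3']; simp only [map_mul, map_pow]; rfl
  -- the two residue cubics, written out
  have hsum : (∑ k ∈ Finset.range (3 + 1), Polynomial.C (residue L (a k)) * Polynomial.X ^ k) =
      Polynomial.C (residue L (a 0)) + Polynomial.C (residue L (a 1)) * Polynomial.X +
        Polynomial.C (residue L (a 2)) * Polynomial.X ^ 2 + Polynomial.C (residue L (a 3)) * Polynomial.X ^ 3 := by
    simp only [Finset.sum_range_succ, Finset.sum_range_zero, zero_add, pow_zero, mul_one, pow_one]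
  have hsum' : (∑ k ∈ Finset.range (3 + 1), Polynomial.C (residue L (a (3 - k))) * Polynomial.X ^ k) =
      Polynomial.C (residue L (a 3)) + Polynomial.C (residue L (a 2)) * Polynomial.X +
        Polynomial.C (residue L (a 1)) * Polynomial.X ^ 2 + Polynomial.C (residue L (a 0)) * Polynomial.X ^ 3 := by
    simp only [Finset.sum_range_succ, Finset.sum_range_zero, zero_add, pow_zero, mul_one, pow_one, Nat.sub_zero,
      Nat.sub_self, Nat.reduceSub]
  -- the determinant `A₁N₂ − A₂N₁ = η̄_Q (a₁b₂ − a₂b₁)¯ ≠ 0`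
  have hN₁' : N₁ = residue L η_S * A₁ + residue L η_Q * residue L b₁ := by
    rw [hN₁, res_eq hν₁]; simp [hA₁]
  have hN₂' : N₂ = residue L η_S * A₂ + residue L η_Q * residue L b₂ := by
    rw [hN₂, res_eq hν₂]; simp [hA₂]
  have hD : A₁ * N₂ - A₂ * N₁ ≠ 0 := by
    have : A₁ * N₂ - A₂ * N₁ = residue L η_Q * residue L (a₁ * b₂ - a₂ * b₁) := by
      rw [hN₁', hN₂']; simp [hA₁, hA₂]; ring
    rw [this]
    exact mul_ne_zero (res_ne hηQ) (res_ne hdet)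
  by_cases hN2 : N₂ = 0
  · -- the reversed cubic `U N₁ X (A₂ + A₁ X)²`
    right
    have hN1 : N₁ ≠ 0 := by
      intro h; apply hD; rw [hN2, h]; ring
    have hA2 : A₂ ≠ 0 := by
      intro h; apply hD; rw [hN2, h]; ring
    refine ⟨Polynomial.X, Polynomial.C (U * N₁) * (Polynomial.C A₂ + Polynomial.C A₁ * Polynomial.X) ^ 2,
      Polynomial.prime_X, ?_, ?_⟩
    · rw [hsum', e0, e1, e2, e3, hN2]
      simp only [map_mul, map_pow, map_ofNat, mul_zero, add_zero, zero_add, map_zero]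
      ring
    · intro hdvd
      have hroot := (Polynomial.dvd_iff_isRoot.mp (by simpa using hdvd) :
        (Polynomial.C (U * N₁) * (Polynomial.C A₂ + Polynomial.C A₁ * Polynomial.X) ^ 2).IsRoot 0)
      simp [Polynomial.IsRoot] at hroot
      rcases hroot with (h | h) | h
      · exact hU0 h
      · exact hN1 h
      · exact hA2 h
  · -- the cubic `U N₂ (A₁ + A₂ X)² (X + N₁/N₂)`
    left
    refine ⟨Polynomial.X - Polynomial.C (-(N₁ / N₂)),
      Polynomial.C (U * N₂) * (Polynomial.C A₁ + Polynomial.C A₂ * Polynomial.X) ^ 2,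
      (Polynomial.irreducible_X_sub_C _).prime, ?_, ?_⟩
    · have hC : Polynomial.C N₂ * Polynomial.C (-(N₁ / N₂)) = -Polynomial.C N₁ := by
        rw [← map_mul, ← map_neg]; congr 1; field_simp
      rw [hsum, e0, e1, e2, e3]
      simp only [map_mul, map_add, map_pow, map_ofNat]
      linear_combination (Polynomial.C U * (Polynomial.C A₁ + Polynomial.C A₂ * Polynomial.X) ^ 2) * hC
    · intro hdvd
      have hπ : Prime (Polynomial.X - Polynomial.C (-(N₁ / N₂)) : Polynomial κ) := (Polynomial.irreducible_X_sub_C _).prime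
      rcases hπ.dvd_or_dvd hdvd with h | h
      · -- a prime does not divide a unit
        have hunit : IsUnit (Polynomial.C (U * N₂) : Polynomial κ) :=
          Polynomial.isUnit_C.mpr (isUnit_iff_ne_zero.mpr (mul_ne_zero hU0 hN2))
        exact hπ.not_unit (isUnit_of_dvd_unit h hunit)
      · have h' := hπ.dvd_of_dvd_pow h
        have hroot := Polynomial.dvd_iff_isRoot.mp h'
        simp only [Polynomial.IsRoot.def, Polynomial.eval_add, Polynomial.eval_mul, Polynomial.eval_C,
          Polynomial.eval_X] at hroot
        apply hD
        have : A₁ * N₂ - A₂ * N₁ = N₂ * (A₁ + A₂ * -(N₁ / N₂)) := by field_simp; ring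
        rw [this, hroot, mul_zero]

end Summit.ResolutionOfSingularities.ResolutionOfSingularities.Theorems.CampaignW46.MohWindowSurface

end
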